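import Literature.Geometry.Riemannian.PeriodicFrameMonodromy
import Literature.LinearAlgebra.Matrix.RotationGroupSmoothPath
import HarnessLib

/-!
# A periodic smooth orthonormal frame along a closed curve in an oriented Riemannian 4-manifold

Topic `Literature/Geometry/Riemannian`.  **Along a `C^∞`, regular, `T`-periodic curve `γ` in an
oriented Riemannian `4`-manifold there is a `T`-PERIODIC `C^∞` orthonormal frame `ν₀, …, ν₃` with
`ν₀` the unit tangent** (`exists_periodic_orthonormal_frame`) — i.e. the normal bundle of an
embedded circle in an orientable manifold is trivial, with an explicit smooth periodic
trivialisation (Hirsch, *Differential Topology* (1976), Ch. 4, §4 Thm. 4.2 ff. and §5; this is the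
frame from which the tubular neighbourhood `S¹ × D³ → M` of the circle is built by the normal
exponential map, Lee, *Introduction to Riemannian Manifolds* (2018), Thm. 5.25).

Proof.  `PeriodicFrameMonodromy.exists_frame_monodromy` gives a frame on `(-T, 2T)` whose normal
part returns after one period twisted by a smooth `P(s) ∈ SO(3)`.  Untwist: with the smooth path
`B : 1 ↝ P(s₁ - T)ᵀ` in `SO(3)` of `RotationGroupSmoothPath.exists_contDiff_path_SO3` and smooth
transitions `μ, κ`, the matrix `R₀(s) = B(μ s) · P(s₁ - T) · P(σ s - T)ᵀ`, `σ s = s₁ + (s - s₁) κ s`,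
is smooth, orthogonal, `= 1` for `s ≤ T/4` and `= P(s - T)ᵀ` for `s ∈ [5T/8, 5T/4)`; the rotated
frame `ν̃ = R₀ ν` then satisfies `ν̃(s + T) = ν̃(s)` for `s` NEAR `0`, and its periodic extension
from `[0, T)` (`toIcoMod`; `periodicExtension_eventuallyEq`) is the required frame.
Everything is proved; no definitions, no named facts.

## References

* M. W. Hirsch, *Differential Topology*, GTM 33 (1976), Ch. 4, §4–§5. [HirschDT1976]
* J. M. Lee, *Introduction to Riemannian Manifolds*, 2nd ed., GTM 176 (2018), Thm. 5.25.
  [LeeRiemannianManifolds2018]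
-/

noncomputable section

open Bundle Set Filter Function Module Matrix
open scoped Manifold ContDiff Topology

namespace Literature.Geometry.Riemannian

open Literature.Geometry.Lorentzian Literature.Topology.FourManifolds Literature.LinearAlgebra.Matrix
  Literature.AlgebraicTopology.FundamentalGroup

/-! ### Periodic extension from a fundamental window -/

/-- `t - ⌊t/T⌋ T ∈ [0, T)` (`toIcoDiv`/`toIcoMod` bookkeeping). [folklore] -/
theorem sub_toIcoDiv_zsmul_mem_Ico {T : ℝ} (hT : 0 < T) (t : ℝ) :
    t - toIcoDiv hT 0 t • T ∈ Ico 0 T := by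
  have h := toIcoMod_mem_Ico hT 0 t
  rw [← self_sub_toIcoDiv_zsmul, zero_add] at h
  exact h

/-- **Periodic extension is locally a translate.**  Let `F : ℝ → X` satisfy `F (s + T) = F s`
for `s ∈ (-δ, δ)`.  Then near every `t`, the `T`-periodic extension `r ↦ F (r mod T)` (values
taken from `[0, T)`) coincides with the translate `r ↦ F (r - k T)`, `k = ⌊t / T⌋`
(`t - k T ∈ [0, T)`). [folklore] -/
theorem periodicExtension_eventuallyEq {X : Type*} {T δ : ℝ} (hT : 0 < T) (hδ : 0 < δ)
    (F : ℝ → X) (hF : ∀ s ∈ Ioo (-δ) δ, F (s + T) = F s) (t : ℝ) :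
    ∀ᶠ r in 𝓝 t, F (toIcoMod hT 0 r) = F (r - toIcoDiv hT 0 t • T) := by
  set k := toIcoDiv hT 0 t with hk
  have hu : t - k • T ∈ Ico 0 T := sub_toIcoDiv_zsmul_mem_Ico hT t
  rcases eq_or_lt_of_le hu.1 with h0 | hpos
  · -- `t = k T`: a seam
    set ε := min δ T with hε
    have hε0 : 0 < ε := lt_min hδ hT
    have hmem : Ioo (t - ε) (t + ε) ∈ 𝓝 t := Ioo_mem_nhds (by linarith) (by linarith)
    filter_upwards [hmem] with r hr
    rcases le_or_gt t r with htr | htr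
    · -- right of the seam: `r - kT ∈ [0, ε)`
      have h1 : toIcoMod hT 0 r = r - k • T := by
        rw [toIcoMod_eq_iff hT]
        refine ⟨⟨by linarith, ?_⟩, k, by ring⟩
        have := hr.2; rw [zero_add]; linarith [min_le_right δ T]
      rw [h1]
    · -- left of the seam: `r - kT ∈ (-ε, 0)` and `r mod T = r - kT + T`
      have h1 : toIcoMod hT 0 r = r - k • T + T := by
        rw [toIcoMod_eq_iff hT]
        refine ⟨⟨?_, ?_⟩, k - 1, ?_⟩
        · have := hr.1; linarith [min_le_right δ T]
        · rw [zero_add]; linarith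
        · rw [sub_smul, one_smul]; ring
      rw [h1]
      refine hF _ ⟨?_, ?_⟩
      · have := hr.1; linarith [min_le_left δ T]
      · linarith [min_le_left δ T]
  · -- interior point of the window: `r - kT ∈ (0, T)` nearby
    set u := t - k • T with huu
    set ε := min u (T - u) with hε
    have hε0 : 0 < ε := lt_min hpos (by linarith [hu.2])
    have hmem : Ioo (t - ε) (t + ε) ∈ 𝓝 t := Ioo_mem_nhds (by linarith) (by linarith)
    filter_upwards [hmem] with r hr
    have h1 : toIcoMod hT 0 r = r - k • T := by
      rw [toIcoMod_eq_iff hT]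
      refine ⟨⟨?_, ?_⟩, k, by ring⟩
      · have := hr.1; linarith [min_le_left u (T - u)]
      · have := hr.2; rw [zero_add]; linarith [min_le_right u (T - u)]
    rw [h1]

/-- A `T`-periodic curve is `kT`-periodic for every integer `k`. [folklore] -/
theorem periodic_zsmul {M : Type*} {γ : ℝ → M} {T : ℝ} (hper : ∀ t, γ (t + T) = γ t) (t : ℝ)
    (k : ℤ) : γ (t + k • T) = γ t := by
  induction k using Int.induction_on generalizing t with
  | zero => simp
  | succ n ih =>
    have h1 : t + ((n : ℤ) + 1) • T = (t + (n : ℤ) • T) + T := by rw [add_smul, one_smul, add_assoc]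
    rw [h1, hper, ih]
  | pred n ih =>
    have h1 : t + (-(n : ℤ) - 1) • T = (t - T) + (-(n : ℤ)) • T := by
      rw [sub_smul, one_smul]; ring
    have h2 := hper (t - T)
    rw [sub_add_cancel] at h2
    rw [h1, ih, ← h2]

variable {E : Type*} [NormedAddCommGroup E] [NormedSpace ℝ E]
  {H : Type*} [TopologicalSpace H] {I : ModelWithCorners ℝ E H}
  {M : Type*} [TopologicalSpace M] [ChartedSpace H M] [IsManifold I ∞ M]

omit [IsManifold I ∞ M] in
/-- The velocity of a `T`-periodic curve is `kT`-periodic for every integer `k`. [folklore] -/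
theorem velocity_add_zsmul {γ : ℝ → M} {T : ℝ} (hper : ∀ t, γ (t + T) = γ t) (t : ℝ) (k : ℤ) :
    velocity I γ (t + k • T) = velocity I γ t := by
  induction k using Int.induction_on generalizing t with
  | zero => exact frame_congr_arg (I := I) (velocity I γ) (by rw [zero_smul, add_zero])
  | succ n ih =>
    have h1 : t + ((n : ℤ) + 1) • T = (t + (n : ℤ) • T) + T := by rw [add_smul, one_smul, add_assoc]
    rw [h1, velocity_add_period hper, ih]
  | pred n ih =>
    have h1 : t + (-(n : ℤ) - 1) • T = (t - T) + (-(n : ℤ)) • T := by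
      rw [sub_smul, one_smul]; ring
    have h2 := velocity_add_period (I := I) hper (t - T)
    rw [sub_add_cancel] at h2
    rw [h1, ih, ← h2]

/-! ### The periodic frame -/

section Frame

variable [FiniteDimensional ℝ E] [CompleteSpace E]
  {cov : CovariantDerivative I E (TangentSpace I : M → Type _)}
  (g : PseudoRiemannianMetric I ∞ E (TangentSpace I : M → Type _))

/-- **A periodic smooth orthonormal frame along a closed curve, first vector the unit tangent**
(Hirsch 1976, Ch. 4 §4–§5: the normal bundle of an embedded circle in an oriented manifold is
trivial).  For a `C^∞`, regular, `T`-periodic curve `γ` (`T > 0`) in a Riemannian `4`-manifold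
with a `SmoothOrientation` and a metric-compatible locally `C^∞` connection there are fields
`ν₀, …, ν₃` along `γ`, everywhere `g`-orthonormal with `C^∞` lifts, `T`-periodic, with
`ν₀ = γ'/|γ'|`. [cite: HirschDT1976, Ch. 4 §4–§5] -/
theorem exists_periodic_orthonormal_frame (hg : g.IsRiemannian) (hcov : g.IsCompatible cov)
    (hreg : cov.IsLocallyContMDiff ∞) (hE : finrank ℝ E = 4) (o : SmoothOrientation I M)
    {γ : ℝ → M} (hγ : ContMDiff 𝓘(ℝ, ℝ) I ∞ γ) {T : ℝ} (hT : 0 < T)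
    (hper : ∀ t, γ (t + T) = γ t) (hvel : ∀ t, velocity I γ t ≠ 0) :
    ∃ ν : Fin 4 → Π t : ℝ, TangentSpace I (γ t),
      (∀ t, ∀ i j, g.val (γ t) (ν i t) (ν j t) = if i = j then 1 else 0) ∧
      (∀ i, ContMDiff 𝓘(ℝ, ℝ) I.tangent ∞
        (fun t ↦ (TotalSpace.mk' E (γ t) (ν i t) : TangentBundle I M))) ∧
      (∀ t, ν 0 t = (Real.sqrt (g.val (γ t) (velocity I γ t) (velocity I γ t)))⁻¹ • velocity I γ t) ∧
      (∀ i t, ν i (t + T) = ν i t) := by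
  classical
  obtain ⟨ν, P, hon, hsm, hν0, hν0per, hexp, hPsm, hPO⟩ :=
    exists_frame_monodromy g hg hcov hreg hE o hγ hT hper hvel
  have hPPt : ∀ s ∈ Ioo (-T) T, P s * (P s)ᵀ = 1 := fun s hs ↦ mul_eq_one_comm.1 (hPO s hs).1
  -- (1) the untwisting matrix `R₀`
  set s₁ : ℝ := 3 * T / 4 with hs₁
  have hs₁m : s₁ - T ∈ Ioo (-T) T := ⟨by rw [hs₁]; linarith, by rw [hs₁]; linarith⟩
  set P₀ : SO3 := ⟨(P (s₁ - T))ᵀ, by rw [transpose_transpose]; exact hPPt _ hs₁m,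
    by rw [det_transpose]; exact (hPO _ hs₁m).2⟩ with hP₀
  obtain ⟨B, hBsm, hBO, hB0, hB1⟩ := exists_contDiff_path_SO3 P₀
  set μ : ℝ → ℝ := fun s ↦ Real.smoothTransition ((s - T / 4) / (T / 4)) with hμ
  set κ : ℝ → ℝ := fun s ↦ Real.smoothTransition ((s - T / 2) / (T / 8)) with hκ
  set σ : ℝ → ℝ := fun s ↦ s₁ + (s - s₁) * κ s with hσ
  have hμsm : ContDiff ℝ ∞ μ := Real.smoothTransition.contDiff.comp (by fun_prop)
  have hκsm : ContDiff ℝ ∞ κ := Real.smoothTransition.contDiff.comp (by fun_prop)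
  have hσsm : ContDiff ℝ ∞ σ := by
    show ContDiff ℝ ∞ (fun s ↦ s₁ + (s - s₁) * κ s); fun_prop
  have hμ0 : ∀ s, s ≤ T / 4 → μ s = 0 := fun s hs ↦
    Real.smoothTransition.zero_of_nonpos (div_nonpos_of_nonpos_of_nonneg (by linarith) (by linarith))
  have hμ1 : ∀ s, T / 2 ≤ s → μ s = 1 := fun s hs ↦
    Real.smoothTransition.one_of_one_le ((one_le_div (by linarith)).2 (by linarith))
  have hκ0 : ∀ s, s ≤ T / 2 → κ s = 0 := fun s hs ↦
    Real.smoothTransition.zero_of_nonpos (div_nonpos_of_nonpos_of_nonneg (by linarith) (by linarith))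
  have hκ1 : ∀ s, 5 * T / 8 ≤ s → κ s = 1 := fun s hs ↦
    Real.smoothTransition.one_of_one_le ((one_le_div (by linarith)).2 (by linarith))
  have hσ_lo : ∀ s, s ≤ T / 2 → σ s = s₁ := fun s hs ↦ by
    show s₁ + (s - s₁) * κ s = s₁; rw [hκ0 s hs, mul_zero, add_zero]
  have hσ_hi : ∀ s, 5 * T / 8 ≤ s → σ s = s := fun s hs ↦ by
    show s₁ + (s - s₁) * κ s = s; rw [hκ1 s hs, mul_one]; ring
  -- `σ s - T` stays in the smooth window `(-T, T)` for `s ∈ (-T/4, 5T/4)`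
  have hσ_mem : ∀ s ∈ Ioo (-T / 4) (5 * T / 4), σ s - T ∈ Ioo (-T) T := by
    intro s hs
    rcases le_or_gt s (T / 2) with h | h
    · rw [hσ_lo s h]; exact hs₁m
    · rcases le_or_gt (5 * T / 8) s with h' | h'
      · rw [hσ_hi s h']; exact ⟨by linarith [hs.1], by linarith [hs.2]⟩
      · -- `σ s` lies between `s` and `s₁`
        have hk0 : 0 ≤ κ s := Real.smoothTransition.nonneg _
        have hk1 : κ s ≤ 1 := Real.smoothTransition.le_one _
        have hle : s ≤ s₁ := by rw [hs₁]; linarith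
        have h1 : s ≤ σ s := by
          show s ≤ s₁ + (s - s₁) * κ s; nlinarith
        have h2 : σ s ≤ s₁ := by
          show s₁ + (s - s₁) * κ s ≤ s₁; nlinarith
        exact ⟨by linarith, by rw [hs₁] at h2; linarith⟩
  set R₀ : ℝ → Matrix (Fin 3) (Fin 3) ℝ := fun s ↦ B (μ s) * P (s₁ - T) * (P (σ s - T))ᵀ with hR₀
  -- `R₀` is orthogonal on the window
  have hR₀O : ∀ s ∈ Ioo (-T / 4) (5 * T / 4), (R₀ s)ᵀ * R₀ s = 1 := by
    intro s hs
    have h1 : (B (μ s))ᵀ * B (μ s) = 1 := (hBO (μ s)).1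
    have h2 : (P (s₁ - T))ᵀ * P (s₁ - T) = 1 := (hPO _ hs₁m).1
    have h3 : P (σ s - T) * (P (σ s - T))ᵀ = 1 := hPPt _ (hσ_mem s hs)
    show (B (μ s) * P (s₁ - T) * (P (σ s - T))ᵀ)ᵀ * (B (μ s) * P (s₁ - T) * (P (σ s - T))ᵀ) = 1
    rw [transpose_mul, transpose_mul, transpose_transpose]
    calc P (σ s - T) * ((P (s₁ - T))ᵀ * (B (μ s))ᵀ) * (B (μ s) * P (s₁ - T) * (P (σ s - T))ᵀ)
        = P (σ s - T) * ((P (s₁ - T))ᵀ * ((B (μ s))ᵀ * B (μ s)) * P (s₁ - T)) * (P (σ s - T))ᵀ := by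
          simp only [Matrix.mul_assoc]
      _ = 1 := by rw [h1, Matrix.mul_one, h2, Matrix.mul_one, h3]
  have hR₀O' : ∀ s ∈ Ioo (-T / 4) (5 * T / 4), R₀ s * (R₀ s)ᵀ = 1 := fun s hs ↦
    mul_eq_one_comm.1 (hR₀O s hs)
  -- `R₀ = 1` to the left, `R₀ s = P(s - T)ᵀ` to the right
  have hR₀_lo : ∀ s, s ≤ T / 4 → R₀ s = 1 := by
    intro s hs
    show B (μ s) * P (s₁ - T) * (P (σ s - T))ᵀ = 1
    rw [hμ0 s hs, hB0 0 le_rfl, Matrix.one_mul, hσ_lo s (by linarith), hPPt _ hs₁m]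
  have hR₀_hi : ∀ s, 5 * T / 8 ≤ s → R₀ s = (P (s - T))ᵀ := by
    intro s hs
    show B (μ s) * P (s₁ - T) * (P (σ s - T))ᵀ = (P (s - T))ᵀ
    rw [hμ1 s (by linarith), hB1 1 le_rfl, hP₀, hσ_hi s hs]
    show (P (s₁ - T))ᵀ * P (s₁ - T) * (P (s - T))ᵀ = (P (s - T))ᵀ
    rw [(hPO _ hs₁m).1, Matrix.one_mul]
  -- smoothness of the entries of `R₀` on the window
  have hR₀sm : ∀ a b, ∀ s ∈ Ioo (-T / 4) (5 * T / 4),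
      ContMDiffAt 𝓘(ℝ, ℝ) 𝓘(ℝ, ℝ) ∞ (fun s' ↦ R₀ s' a b) s := by
    intro a b s hs
    rw [contMDiffAt_iff_contDiffAt]
    have hBe : ∀ i j, ContDiffAt ℝ ∞ (fun s' ↦ B (μ s') i j) s := fun i j ↦
      ((hBsm i j).comp hμsm).contDiffAt
    have hPe : ∀ i j, ContDiffAt ℝ ∞ (fun s' ↦ P (σ s' - T) i j) s := fun i j ↦ by
      have h1 : ContDiffAt ℝ ∞ (fun r ↦ P r i j) (σ s - T) :=
        contMDiffAt_iff_contDiffAt.1 (hPsm i j _ (hσ_mem s hs))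
      exact h1.comp s (hσsm.contDiffAt.sub contDiffAt_const)
    show ContDiffAt ℝ ∞ (fun s' ↦ (B (μ s') * P (s₁ - T) * (P (σ s' - T))ᵀ) a b) s
    simp only [Matrix.mul_apply, Matrix.transpose_apply]
    refine ContDiffAt.sum fun c _ ↦ (ContDiffAt.sum fun d _ ↦ ?_).mul (hPe b c)
    exact (hBe a d).mul contDiffAt_const
  -- (2) the untwisted frame on the window
  have hW : ∀ s ∈ Ioo (-T / 4) (5 * T / 4), s ∈ Ioo (-T) (2 * T) := fun s hs ↦
    ⟨by linarith [hs.1], by linarith [hs.2]⟩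
  set νt : Fin 4 → Π t : ℝ, TangentSpace I (γ t) := fun i ↦ Fin.cases (ν 0)
    (fun a t ↦ ∑ b : Fin 3, R₀ t a b • ν b.succ t) i with hνt
  have hνt0 : ∀ t, νt 0 t = ν 0 t := fun t ↦ rfl
  have hνts : ∀ (a : Fin 3) t, νt a.succ t = ∑ b : Fin 3, R₀ t a b • ν b.succ t := fun a t ↦ rfl
  have hon3 : ∀ s ∈ Ioo (-T) (2 * T), ∀ a b : Fin 3,
      g.val (γ s) (ν a.succ s) (ν b.succ s) = if a = b then 1 else 0 := by
    intro s hs a b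
    rw [hon s hs]
    simp only [Fin.succ_inj]
  -- orthonormality on the window
  have h0s : ∀ c : Fin 3, (0 : Fin 4) ≠ c.succ := fun c ↦ (Fin.succ_ne_zero c).symm
  have hνt_on : ∀ s ∈ Ioo (-T / 4) (5 * T / 4), ∀ i j,
      g.val (γ s) (νt i s) (νt j s) = if i = j then 1 else 0 := by
    intro s hs i j
    refine Fin.cases (Fin.cases ?_ (fun b ↦ ?_) j) (fun a ↦ Fin.cases ?_ (fun b ↦ ?_) j) i
    · rw [hνt0]; exact hon s (hW s hs) 0 0
    · rw [hνt0, hνts, map_sum]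
      simp only [map_smul, smul_eq_mul, hon s (hW s hs), h0s, if_false, mul_zero,
        Finset.sum_const_zero]
    · rw [hνt0, hνts, map_sum]
      simp only [map_smul, FunLike.coe_sum, FunLike.coe_smul, Finset.sum_apply, Pi.smul_apply,
        smul_eq_mul, hon s (hW s hs), Fin.succ_ne_zero, if_false, mul_zero, Finset.sum_const_zero]
    · rw [hνts, hνts, val_sum_smul_sum_smul g (hon3 s (hW s hs))]
      have h := congrFun (congrFun (hR₀O' s hs) a) b
      rw [Matrix.mul_apply, Matrix.one_apply] at h
      simp only [Matrix.transpose_apply] at h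
      rw [h]
      simp only [Fin.succ_inj]
  -- smooth lifts on the window
  have hνt_sm : ∀ i, ∀ s ∈ Ioo (-T / 4) (5 * T / 4), ContMDiffAt 𝓘(ℝ, ℝ) I.tangent ∞
      (fun t ↦ (TotalSpace.mk' E (γ t) (νt i t) : TangentBundle I M)) s := by
    intro i s hs
    refine Fin.cases ?_ (fun a ↦ ?_) i
    · exact hsm 0 s (hW s hs)
    · show ContMDiffAt 𝓘(ℝ, ℝ) I.tangent ∞
        (fun t ↦ (TotalSpace.mk' E (γ t) (∑ b : Fin 3, R₀ t a b • ν b.succ t) : TangentBundle I M)) s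
      exact contMDiffAt_liftAlong_sum_smul (hγ s) (fun b ↦ hsm b.succ s (hW s hs))
        (fun b ↦ hR₀sm a b s hs)
  -- compatibility across one period near `0`
  have hνt_per : ∀ i, ∀ s ∈ Ioo (-(T / 4)) (T / 4), (νt i (s + T) : E) = νt i s := by
    intro i s hs
    have hs' : s ∈ Ioo (-T) T := ⟨by linarith [hs.1], by linarith [hs.2]⟩
    refine Fin.cases ?_ (fun a ↦ ?_) i
    · rw [hνt0, hνt0]; exact hν0per s hs'
    · rw [hνts, hνts, hR₀_hi (s + T) (by linarith [hs.1]), hR₀_lo s hs.2.le, add_sub_cancel_right]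
      simp only [Matrix.transpose_apply, Matrix.one_apply, ite_smul, one_smul, zero_smul,
        Finset.sum_ite_eq, Finset.mem_univ, if_true]
      have hPtP := (hPO s hs').1
      calc (∑ b, P s b a • ν b.succ (s + T) : E)
          = ∑ b, P s b a • ∑ c, P s b c • ν c.succ s := by simp_rw [hexp s hs']; rfl
        _ = ∑ c, (∑ b, P s b a * P s b c) • ν c.succ s := by
            simp_rw [Finset.smul_sum, smul_smul]
            rw [Finset.sum_comm]
            simp_rw [Finset.sum_smul]
        _ = ∑ c, ((P s)ᵀ * P s) a c • ν c.succ s := by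
            simp only [Matrix.mul_apply, Matrix.transpose_apply]
        _ = ν a.succ s := by
            rw [hPtP]
            simp only [Matrix.one_apply, ite_smul, one_smul, zero_smul, Finset.sum_ite_eq,
              Finset.mem_univ, if_true]
  -- (3) the periodic extension from `[0, T)`
  have hT4 : 0 < T / 4 := by linarith
  have hIco : ∀ u ∈ Ico 0 T, u ∈ Ioo (-T / 4) (5 * T / 4) := fun u hu ↦
    ⟨by linarith [hu.1], by linarith [hu.2]⟩
  set νp : Fin 4 → Π t : ℝ, TangentSpace I (γ t) :=
    fun i t ↦ (νt i (toIcoMod hT 0 t) : E) with hνp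
  have hνp_apply : ∀ i t, (νp i t : E) = νt i (toIcoMod hT 0 t) := fun i t ↦ rfl
  -- bookkeeping at a parameter `t`: `t = u + kT`, `u ∈ [0, T)`
  have hdecomp : ∀ t, toIcoMod hT 0 t + toIcoDiv hT 0 t • T = t := fun t ↦
    toIcoMod_add_toIcoDiv_zsmul hT 0 t
  have hγu : ∀ t, γ t = γ (toIcoMod hT 0 t) := fun t ↦ by
    conv_lhs => rw [← hdecomp t]
    exact periodic_zsmul hper _ _
  have hvu : ∀ t, velocity I γ t = velocity I γ (toIcoMod hT 0 t) := fun t ↦ by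
    have h := velocity_add_zsmul (I := I) hper (toIcoMod hT 0 t) (toIcoDiv hT 0 t)
    rw [hdecomp t] at h
    exact h
  have humem : ∀ t, toIcoMod hT 0 t ∈ Ioo (-T / 4) (5 * T / 4) := fun t ↦
    hIco _ (by simpa using toIcoMod_mem_Ico hT 0 t)
  refine ⟨νp, fun t i j ↦ ?_, fun i t ↦ ?_, fun t ↦ ?_, fun i t ↦ ?_⟩
  · -- orthonormal everywhere
    show g.val (γ t) (νt i (toIcoMod hT 0 t)) (νt j (toIcoMod hT 0 t)) = _
    rw [hγu t]
    exact hνt_on _ (humem t) i j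
  · -- `C^∞` lift at every `t`: locally a translate of the window frame
    have hev := periodicExtension_eventuallyEq hT hT4 (fun s ↦ (νt i s : E))
      (fun s hs ↦ hνt_per i s hs) t
    set k := toIcoDiv hT 0 t with hk
    have hu : t - k • T = toIcoMod hT 0 t := self_sub_toIcoDiv_zsmul hT 0 t
    have h1 : ContMDiffAt 𝓘(ℝ, ℝ) I.tangent ∞
        (fun r ↦ (TotalSpace.mk' E (γ (r - k • T)) (νt i (r - k • T)) : TangentBundle I M)) t := by
      have h := hνt_sm i (toIcoMod hT 0 t) (humem t)
      rw [← hu] at h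
      exact h.comp t (contMDiffAt_id.sub contMDiffAt_const)
    refine h1.congr_of_eventuallyEq ?_
    filter_upwards [hev] with r hr
    have hb : γ r = γ (r - k • T) := by
      have h := periodic_zsmul hper (r - k • T) k
      rw [sub_add_cancel] at h
      exact h
    show (TotalSpace.mk' E (γ r) (νt i (toIcoMod hT 0 r)) : TangentBundle I M) = _
    rw [hr, hb]
  · -- `ν₀` is the unit tangent
    show (νt 0 (toIcoMod hT 0 t) : E) = _
    rw [hνt0, hν0 _ (hW _ (humem t)), hvu t, hγu t]
  · -- periodicity
    show (νt i (toIcoMod hT 0 (t + T)) : E) = νt i (toIcoMod hT 0 t)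
    exact frame_congr_arg (I := I) (νt i) (toIcoMod_add_right hT 0 t)

end Frame

end Literature.Geometry.Riemannian

end
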